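import Summits.BirchSwinnertonDyer.BirchSwinnertonDyer.Theorems.ManinLocalTwoThreeSemistableTwistTameAtThree
import Summits.BirchSwinnertonDyer.Rank1Residual.Additive.GordTwistMinimalModel
import Literature.NumberTheory.EllipticCurves.QuadraticTwistSwanConductorMaxProofs
import Literature.NumberTheory.EllipticCurves.TateModuleTameDescentProofs
import Literature.NumberTheory.EllipticCurves.TateModuleTwistTransportProofs
import Literature.NumberTheory.EllipticCurves.SzpiroLocalDataProofs
import HarnessLib

/-!
# Quadratic twists do not move the WILD exponent at `3`: `f₃(W ⊗ d) = f₃(W)` whenever both are additive; `27 ∣ N(W)` ⟹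
# `v₃(N(W ⊗ d)) = v₃(N(W))` for every `d`, and `N(W ⊗ ℚ(√−3)) = N(W)` on the nose
# (route `ManinLocalTwoThree`, crux C3 `ManinPrimeToThreeAtNine` stmt-BirchSwinnertonDyer-22968; cell bsd-f2-manin, p2 gen 15)

E-blind local law, Galois side: a quadratic character is TAME at `3`, so every upper ramification group `Γ^u(𝔓)`, `u > 0`, fixes `√d`
(`absUpperRamificationSubgroup_le_inertia_inf_of_not_dvd_index` with `[ℚ(√d) : ℚ] ≤ 2` prime to `3`), whence `Sw_𝔓(V_ℓ(W ⊗ d)) = Sw_𝔓(V_ℓ W)`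
(`swanConductorAt_rationalTate_quadraticTwist_eq_of_forall_smul_geomSqrt_eq`), and Ogg's formula at `3` (tree theorem
`swanConductorAt_rationalTate_eq_wildConductorExponent_of_ringChar_eq_three_holds`) turns this into `δ₃(W ⊗ d) = δ₃(W)` when both curves are
additive at `3`; `f = ε + δ` with `ε = 2` gives `f₃(W ⊗ d) = f₃(W)`.
* §1 `conductorExponent_quadraticTwist_eq_of_hasAdditiveReductionAt_three` (𝓞 ℚ place) and `…_placeOf_three` (ℤ place);
* §2 `factorization_three_conductorNorm_quadraticTwist_eq_of_twentyseven_dvd`: `27 ∣ N(W)` ⟹ `v₃(N(W ⊗ d)) = v₃(N(W))` for EVERY `d ≠ 0` (the twist is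
  additive by p707513) — the C3 core's wild stratum is closed under all quadratic twists, level-part at `3` included;
* §3 `conductorNorm_quadraticTwist_negThree_eq_of_twentyseven_dvd`: `27 ∣ N(W)` ⟹ `N(W ⊗ ℚ(√−3)) = N(W)` (off `3` the twist by `−3 = 3*` is
  unramified: `conductorExponent_eq_of_twist_pStar_of_ne`); this DISCHARGES the standing hypothesis «`N(W′) = N(W)`» of the cell's `χ₋₃`-orbit
  laws (E-an-5 / E-an-13 `NegThreeOrbitDegreeGrowth`, MEMO-an §63) on the wild stratum.
HONEST FRAMING: local structure theorems (Silverman *ATAEC* IV.10–11 in the tree's Galois-representation currency); nothing about BSD, Manin's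
conjecture or C3 is proved.  No definitions, no named facts, no sorry.
[cite: SilvermanATAEC1994, Thm. IV.10.2(b),(c) and proof (PDF pp. 358–362); Thm. IV.11.1 (p = 3)] [cite: SerreLocalFields1979, Ch. IV §3 Remark 1, Ch. VI §2]
-/

set_option autoImplicit false
-- lint-debt: the directory name repeats the summit name (sibling precedent `ManinLocalTwoThreeSemistableTwistTameAtThree.lean`)
set_option linter.dupNamespace false

noncomputable section

open scoped NumberField
open WeierstrassCurve NumberField Field IsDedekindDomain IsDedekindDomain.HeightOneSpectrum Rat.HeightOneSpectrum
  Literature.NumberTheory.GaloisRepresentations Literature.NumberTheory.EllipticCurves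
  Literature.NumberTheory.DiophantineGeometry
  Summit.BirchSwinnertonDyer.Rank1Residual.Additive
  Summit.BirchSwinnertonDyer.BirchSwinnertonDyer.Theorems.SwanConductorAtThree

namespace Summit.BirchSwinnertonDyer.BirchSwinnertonDyer.Theorems.ManinLocalTwoThree

/-! ## §1 Both additive ⟹ equal conductor exponents at `3` -/

/-- **At `v ∋ 3`: if `W` and `W ⊗ d` are both additive at `v`, then `δ_v(W ⊗ d) = δ_v(W)`** (Swan conductors of `V₂` agree because every
`Γ^u(𝔓)`, `u > 0`, fixes `√d`; Ogg's formula at `3` on both sides). [cite: SilvermanATAEC1994, Thm. IV.10.2(b),(c), IV.11.1 (p = 3)] -/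
theorem wildConductorExponent_quadraticTwist_eq_of_hasAdditiveReductionAt_three (W : WeierstrassCurve ℚ) [W.IsElliptic]
    {v : HeightOneSpectrum (𝓞 ℚ)} (hv : (3 : 𝓞 ℚ) ∈ v.asIdeal) {d : ℚ} (hd : d ≠ 0)
    (hadd : W.HasAdditiveReductionAt v) (hadd' : (haveI := W.isElliptic_quadraticTwist hd; (W.quadraticTwist d).HasAdditiveReductionAt v)) :
    (W.quadraticTwist d).wildConductorExponent v = W.wildConductorExponent v := by
  haveI : Fact (Nat.Prime 2) := ⟨Nat.prime_two⟩
  haveI := W.isElliptic_quadraticTwist hd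
  have h := W.continuous_rationalGaloisRepTate_holds 2
  have h' := (W.quadraticTwist d).continuous_rationalGaloisRepTate_holds 2
  obtain ⟨𝔓, h𝔓⟩ := v.primesAbove_nonempty
  have hℓv : ((2 : ℕ) : 𝓞 ℚ) ∉ v.asIdeal := two_notMem hv
  haveI := stabilizer_geomSqrt_normal d (K := ℚ)
  -- every `Γ^u(𝔓)`, `u > 0`, fixes `√d`
  have hD : ∀ u : ℝ, 0 < u → ∀ σ ∈ absUpperRamificationSubgroup (𝓞 ℚ) 𝔓 u, σ • geomSqrt d = geomSqrt d := by
    intro u hu σ hσ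
    have hle := absUpperRamificationSubgroup_le_inertia_inf_of_not_dvd_index h𝔓 (MulAction.stabilizer (absoluteGaloisGroup ℚ) (geomSqrt d))
      (isOpen_stabilizer_geomSqrt d) (by rw [ringChar_eq_three hv]; exact not_dvd_index_stabilizer_geomSqrt d Nat.prime_three (by decide)) hu
    exact MulAction.mem_stabilizer_iff.mp (Subgroup.mem_inf.mp (hle hσ)).2
  have hSw := W.swanConductorAt_rationalTate_quadraticTwist_eq_of_forall_smul_geomSqrt_eq 2 hd h h' hℓv h𝔓 hD
  rw [(W.quadraticTwist d).swanConductorAt_rationalTate_eq_wildConductorExponent_of_ringChar_eq_three_holds 2 h' v hℓv hadd'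
      (ringChar_eq_three hv) h𝔓,
    W.swanConductorAt_rationalTate_eq_wildConductorExponent_of_ringChar_eq_three_holds 2 h v hℓv hadd (ringChar_eq_three hv) h𝔓] at hSw
  exact_mod_cast hSw

/-- **At `v ∋ 3`: `W`, `W ⊗ d` both additive ⟹ `f_v(W ⊗ d) = f_v(W)`** (`f = ε + δ`, `ε = 2` on both sides).
[cite: SilvermanATAEC1994, Thm. IV.10.2, IV.11.1 (p = 3)] -/
theorem conductorExponent_quadraticTwist_eq_of_hasAdditiveReductionAt_three (W : WeierstrassCurve ℚ) [W.IsElliptic]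
    {v : HeightOneSpectrum (𝓞 ℚ)} (hv : (3 : 𝓞 ℚ) ∈ v.asIdeal) {d : ℚ} (hd : d ≠ 0)
    (hadd : W.HasAdditiveReductionAt v) (hadd' : (haveI := W.isElliptic_quadraticTwist hd; (W.quadraticTwist d).HasAdditiveReductionAt v)) :
    (haveI := W.isElliptic_quadraticTwist hd; (W.quadraticTwist d).conductorExponent v) = W.conductorExponent v := by
  haveI := W.isElliptic_quadraticTwist hd
  haveI : PerfectField (IsLocalRing.ResidueField (v.adicCompletionIntegers ℚ)) := PerfectField.ofFinite
  have hδ := wildConductorExponent_quadraticTwist_eq_of_hasAdditiveReductionAt_three W hv hd hadd hadd'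
  have hK : (W.kodairaSymbolAt v).IsAdditive := (W.isAdditive_kodairaSymbolAt_iff_holds v).mpr hadd
  have hK' : ((W.quadraticTwist d).kodairaSymbolAt v).IsAdditive := ((W.quadraticTwist d).isAdditive_kodairaSymbolAt_iff_holds v).mpr hadd'
  have h2 : 2 ≤ W.conductorExponent v := (two_le_conductorExponent_iff_holds v W).mpr hadd
  have h2' : 2 ≤ (W.quadraticTwist d).conductorExponent v := (two_le_conductorExponent_iff_holds v _).mpr hadd'
  rw [WeierstrassCurve.wildConductorExponent, WeierstrassCurve.wildConductorExponent, tameConductorExponent_eq_two_of_isAdditive hK,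
    tameConductorExponent_eq_two_of_isAdditive hK'] at hδ
  omega

/-- **At the place `placeOf 3` of `ℤ`: `W`, `W ⊗ d` both additive ⟹ `f₃(W ⊗ d) = f₃(W)`.** [cite: SilvermanATAEC1994, Thm. IV.10.2, IV.11.1 (p = 3)] -/
theorem conductorExponent_quadraticTwist_placeOf_three_eq_of_hasAdditiveReductionAt (W : WeierstrassCurve ℚ) [W.IsElliptic]
    {d : ℚ} (hd : d ≠ 0) (hadd : W.HasAdditiveReductionAt (placeOf 3))
    (hadd' : (haveI := W.isElliptic_quadraticTwist hd; (W.quadraticTwist d).HasAdditiveReductionAt (placeOf 3))) :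
    (haveI := W.isElliptic_quadraticTwist hd; (W.quadraticTwist d).conductorExponent (placeOf 3)) = W.conductorExponent (placeOf 3) := by
  haveI := W.isElliptic_quadraticTwist hd
  set w : HeightOneSpectrum (𝓞 ℚ) := (primesEquiv (R := 𝓞 ℚ)).symm ⟨3, Nat.prime_three⟩ with hw
  have hw3 : (3 : 𝓞 ℚ) ∈ w.asIdeal := three_mem_asIdeal_primesEquiv_symm_three
  have haddw : W.HasAdditiveReductionAt w := by
    rw [hw, ← W.hasAdditiveReductionAt_int_iff_ringOfIntegers ⟨3, Nat.prime_three⟩]; exact hadd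
  have haddw' : (W.quadraticTwist d).HasAdditiveReductionAt w := by
    rw [hw, ← (W.quadraticTwist d).hasAdditiveReductionAt_int_iff_ringOfIntegers ⟨3, Nat.prime_three⟩]; exact hadd'
  have h := conductorExponent_quadraticTwist_eq_of_hasAdditiveReductionAt_three W hw3 hd haddw haddw'
  rwa [conductorExponent_eq_condExp_three W hw3, conductorExponent_eq_condExp_three (W.quadraticTwist d) hw3] at h

/-! ## §2 `27 ∣ N(W)`: the `3`-part of the conductor is invariant under every quadratic twist -/

/-- **`27 ∣ N(W)` ⟹ `v₃(N(W ⊗ d)) = v₃(N(W))` for every `d ≠ 0`** (the twist is additive at `3` by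
`hasAdditiveReductionAt_quadraticTwist_placeOf_three_of_twentyseven_dvd`, then §1). [cite: SilvermanATAEC1994, Thm. IV.10.2, IV.11.1 (p = 3)] -/
theorem factorization_three_conductorNorm_quadraticTwist_eq_of_twentyseven_dvd (W : WeierstrassCurve ℚ) [W.IsElliptic]
    (h27 : 3 ^ 3 ∣ W.conductorNorm ℤ) {d : ℚ} (hd : d ≠ 0) :
    (haveI := W.isElliptic_quadraticTwist hd; ((W.quadraticTwist d).conductorNorm ℤ).factorization 3) = (W.conductorNorm ℤ).factorization 3 := by
  haveI := W.isElliptic_quadraticTwist hd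
  haveI : PerfectField (IsLocalRing.ResidueField ((placeOf 3).adicCompletionIntegers ℚ)) := PerfectField.ofFinite
  have hfac : (W.conductorNorm ℤ).factorization 3 = W.conductorExponent (placeOf 3) := factorization_conductorNorm_primesEquiv_symm W ⟨3, Nat.prime_three⟩
  have hfac' : ((W.quadraticTwist d).conductorNorm ℤ).factorization 3 = (W.quadraticTwist d).conductorExponent (placeOf 3) :=
    factorization_conductorNorm_primesEquiv_symm _ ⟨3, Nat.prime_three⟩
  have hadd : W.HasAdditiveReductionAt (placeOf 3) := by
    refine (two_le_conductorExponent_iff_holds (placeOf 3) W).mp ?_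
    rw [← hfac]
    have := (Nat.prime_three.pow_dvd_iff_le_factorization (W.conductorNorm_pos_holds).ne').mp h27
    omega
  have hadd' := hasAdditiveReductionAt_quadraticTwist_placeOf_three_of_twentyseven_dvd W h27 hd
  rw [hfac, hfac']
  exact conductorExponent_quadraticTwist_placeOf_three_eq_of_hasAdditiveReductionAt W hd hadd hadd'

/-- **`27 ∣ N(W)` ⟹ `27 ∣ N(W ⊗ d)`** for every `d ≠ 0`: the wild stratum at `3` is closed under quadratic twists. [cite: SilvermanATAEC1994, IV.11.1 (p = 3)] -/
theorem twentyseven_dvd_conductorNorm_quadraticTwist_of_twentyseven_dvd (W : WeierstrassCurve ℚ) [W.IsElliptic]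
    (h27 : 3 ^ 3 ∣ W.conductorNorm ℤ) {d : ℚ} (hd : d ≠ 0) :
    (haveI := W.isElliptic_quadraticTwist hd; 3 ^ 3 ∣ (W.quadraticTwist d).conductorNorm ℤ) := by
  haveI := W.isElliptic_quadraticTwist hd
  rw [Nat.prime_three.pow_dvd_iff_le_factorization ((W.quadraticTwist d).conductorNorm_pos_holds).ne',
    factorization_three_conductorNorm_quadraticTwist_eq_of_twentyseven_dvd W h27 hd]
  exact (Nat.prime_three.pow_dvd_iff_le_factorization (W.conductorNorm_pos_holds).ne').mp h27

/-! ## §3 `27 ∣ N(W)` ⟹ `N(W ⊗ ℚ(√−3)) = N(W)` -/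

/-- **`27 ∣ N(W)` ⟹ `N(W ⊗ ℚ(√−3)) = N(W)`**: at `3` by §2; off `3` the twist by `−3 = 3*` is unramified, so `f_p` is unchanged
(`conductorExponent_eq_of_twist_pStar_of_ne`).  Discharges the «same conductor» hypothesis of the cell's `χ₋₃`-orbit laws on the wild stratum.
[cite: SilvermanATAEC1994, Thm. IV.10.2, IV.11.1 (p = 3)] [cite: SilvermanAEC2009, X.2 Prop. 2.4] -/
theorem conductorNorm_quadraticTwist_negThree_eq_of_twentyseven_dvd (W : WeierstrassCurve ℚ) [W.IsElliptic]
    (h27 : 3 ^ 3 ∣ W.conductorNorm ℤ) :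
    (haveI := W.isElliptic_quadraticTwist (show ((-3 : ℤ) : ℚ) ≠ 0 by norm_num); (W.quadraticTwist ((-3 : ℤ) : ℚ)).conductorNorm ℤ) =
      W.conductorNorm ℤ := by
  haveI : Fact (Nat.Prime 3) := ⟨Nat.prime_three⟩
  have hd0 : ((-3 : ℤ) : ℚ) ≠ 0 := by norm_num
  haveI := W.isElliptic_quadraticTwist hd0
  have hN0 : W.conductorNorm ℤ ≠ 0 := (W.conductorNorm_pos_holds).ne'
  have hN0' : (W.quadraticTwist ((-3 : ℤ) : ℚ)).conductorNorm ℤ ≠ 0 := ((W.quadraticTwist ((-3 : ℤ) : ℚ)).conductorNorm_pos_holds).ne'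
  -- the twist as `1 • W^{(3*)}`
  have hC : (1 : VariableChange ℚ) • W.quadraticTwist ((-1 : ℚ) ^ (3 / 2) * 3) = W.quadraticTwist ((-3 : ℤ) : ℚ) := by
    rw [one_smul]; norm_num
  -- exponents agree prime by prime
  have hexp : ∀ p : Nat.Primes, (W.quadraticTwist ((-3 : ℤ) : ℚ)).conductorExponent ((primesEquiv (R := ℤ)).symm p) =
      W.conductorExponent ((primesEquiv (R := ℤ)).symm p) := by
    intro p
    by_cases hp3 : (p : ℕ) = 3
    · have hp' : p = ⟨3, Nat.prime_three⟩ := Subtype.ext hp3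
      subst hp'
      have e1 : (W.conductorNorm ℤ).factorization 3 = W.conductorExponent ((primesEquiv (R := ℤ)).symm ⟨3, Nat.prime_three⟩) :=
        factorization_conductorNorm_primesEquiv_symm W ⟨3, Nat.prime_three⟩
      have e2 : ((W.quadraticTwist ((-3 : ℤ) : ℚ)).conductorNorm ℤ).factorization 3 =
          (W.quadraticTwist ((-3 : ℤ) : ℚ)).conductorExponent ((primesEquiv (R := ℤ)).symm ⟨3, Nat.prime_three⟩) :=
        factorization_conductorNorm_primesEquiv_symm _ ⟨3, Nat.prime_three⟩
      rw [← e1, ← e2]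
      exact factorization_three_conductorNorm_quadraticTwist_eq_of_twentyseven_dvd W h27 hd0
    · have hgen : natGenerator ((primesEquiv (R := ℤ)).symm p) = p := congrArg Subtype.val ((primesEquiv (R := ℤ)).apply_symm_apply p)
      exact conductorExponent_eq_of_twist_pStar_of_ne 3 (by decide) W _ 1 hC _ (by rw [hgen]; exact hp3)
  refine Nat.eq_of_factorization_eq hN0' hN0 fun q ↦ ?_
  by_cases hq : q.Prime
  · have e1 : (W.conductorNorm ℤ).factorization q = W.conductorExponent ((primesEquiv (R := ℤ)).symm ⟨q, hq⟩) :=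
      factorization_conductorNorm_primesEquiv_symm W ⟨q, hq⟩
    have e2 : ((W.quadraticTwist ((-3 : ℤ) : ℚ)).conductorNorm ℤ).factorization q =
        (W.quadraticTwist ((-3 : ℤ) : ℚ)).conductorExponent ((primesEquiv (R := ℤ)).symm ⟨q, hq⟩) :=
      factorization_conductorNorm_primesEquiv_symm _ ⟨q, hq⟩
    rw [e1, e2]
    exact hexp ⟨q, hq⟩
  · rw [Nat.factorization_eq_zero_of_not_prime _ hq, Nat.factorization_eq_zero_of_not_prime _ hq]

end Summit.BirchSwinnertonDyer.BirchSwinnertonDyer.Theorems.ManinLocalTwoThree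

end
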